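import Summits.MatrixMultiplication.OmegaCensus.SmallFormats.MatMul228GF3K4EntryNonzeroRZ
import HarnessLib

/-!
# ω-census family (a): the NON-ZERO entries of the K4 certificates — kind CZ (explicit ZKKI output against a term of the same all-ones row)

Cell `pub-omega` (unit `pub-omega-tensor`, gen 42), topic `Summits/MatrixMultiplication/OmegaCensus` (sub-folder `SmallFormats`). Framing (verbatim): lottery
ticket; floor = certified bounds/negative ranges. HONEST FRAMING: step 2b (non-zero half, second kind) of the kernel route to «K4 is not an X-marginal»
(K4-KERNEL-BLUEPRINT.md §8); the mirror image of `K4EntryNonzero.Q_ne_zero_RZ`. `Q_ne_zero_CZ`: `s` = the ZKKI column single at `(vs, μs)` (`μs ∈ {0,2}`,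
`vs ∈ {2,3}`; explicit output shape `W_s q = (w·rep Dr q) • Σ rep sx l • b μs l`, `w ≠ 0`, `sx ≠ s₀ =` the null representative of the block `(b μs · c vs)`),
`t` = the term of the same all-ones ROW `vs` at a column `mt ≠ μs`, `K4Defs.kills (rowcode vs) mt μs = false`, and `rep μs ⬝ᵥ (Y *ᵥ rep Dr) ≠ 0` ⇒
`Σ_{p,q} Y q p (W_s p ⬝ᵥ Grow_t q) ≠ 0`. Proof: transpose symmetry of the entry (`Q_symm`) + `ZKEntries.Q_ne_zero_iff` with the roles of (G, c) and (W, b)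
exchanged (cheapness of `t` for the column `μs` via `CheapSpans.g_vecMulVec_eq_sum`); `z ≠ 0` from `InvertibleAtPairs.det_ne_zero_row` /
`ColumnSubcomp.sees_cheap_input` (pair cell) or the rank-one shape of the all-ones row + `ZKEntries.kcov_dot_ne_zero`. Nothing here is a bound on `ω`.
-/

namespace Summit.MatrixMultiplication.OmegaCensus.SmallFormats

open Finset Matrix
open Literature.Computability.AlgebraicComplexity

namespace K4EntryNonzeroCZ

/-- Transpose symmetry of an entry: `Σ Y q p (W p ⬝ᵥ G q) = Σ Yᵀ q p (G p ⬝ᵥ W q)`. -/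
theorem Q_symm {n : ℕ} (Y : Matrix (Fin 2) (Fin 2) (ZMod 3)) (W G : Matrix (Fin 2) (Fin n) (ZMod 3)) :
    (∑ p, ∑ q, Y q p * (W p ⬝ᵥ G q)) = ∑ p, ∑ q, Yᵀ q p * (G p ⬝ᵥ W q) := by
  rw [Finset.sum_comm]
  refine Finset.sum_congr rfl fun p _ => Finset.sum_congr rfl fun q _ => ?_
  rw [Matrix.transpose_apply, dotProduct_comm]

/-- **Non-zero entry, kind CZ.** -/
theorem Q_ne_zero_CZ (β : BilinComp (mulBilin (ZMod 3) 2 2 8) (Fin 27)) (c b : Fin 4 → Fin 2 → (Fin 8 → ZMod 3))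
    (hbi : ∀ μ (a : Fin 2 → ZMod 3), ∑ m, a m • b μ m = 0 → ∀ m, a m = 0)
    (hbch : ∀ μ t, t ∉ (![{16, 17, 20, 24}, {11, 15, 19, 23}, {13, 14, 22, 26}, {12, 18, 21, 25}] : Fin 4 → Finset (Fin 27)) μ → ∀ m, β.g t (Matrix.vecMulVec (![-((![![1, 0], ![0, 1], ![1, 1], ![1, 2]] : Fin 4 → Fin 2 → ZMod 3) μ 1), (![![1, 0], ![0, 1], ![1, 1], ![1, 2]] : Fin 4 → Fin 2 → ZMod 3) μ 0] : Fin 2 → ZMod 3) (b μ m)) = 0)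
    (hcr : ∀ v s, s ∈ (![{15, 16, 17, 18}, {11, 12, 13, 14}, {23, 24, 25, 26}, {19, 20, 21, 22}] : Fin 4 → Finset (Fin 27)) v → ∀ κ : Fin 2, ∃ a : Fin 2 → ZMod 3, (fun j => β.g s (Matrix.single κ j (1 : ZMod 3))) = ∑ m, a m • c v m)
    (Lrow : Fin 4 → Fin 4 → Fin 4) (rowcode : Fin 4 → Fin 9)
    (hLa : ∀ v : Fin 4, (v = 2 ∨ v = 3) → ∀ j m, (∑ l, (![![1, 0], ![0, 1], ![1, 1], ![1, 2]] : Fin 4 → Fin 2 → ZMod 3) (Lrow v j) l • c v l) ⬝ᵥ b j m = 0)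
    (hLb : ∀ v : Fin 4, (v = 2 ∨ v = 3) → ∀ j (x : Fin 2 → ZMod 3), (∀ m, (∑ l, x l • c v l) ⬝ᵥ b j m = 0) → (x 0 * (![![1, 0], ![0, 1], ![1, 1], ![1, 2]] : Fin 4 → Fin 2 → ZMod 3) (Lrow v j) 1 - x 1 * (![![1, 0], ![0, 1], ![1, 1], ![1, 2]] : Fin 4 → Fin 2 → ZMod 3) (Lrow v j) 0) = 0)
    (hLf : ∀ v : Fin 4, (v = 2 ∨ v = 3) → ∀ a bb j, a ≠ bb → Lrow v a = Lrow v bb → j ≠ a → j ≠ bb →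
      ∃ η : Fin 2 → ZMod 3, ∀ q : Fin 2, (fun jj => β.g (K4Defs.cellTerm v j) (Matrix.single q jj (1 : ZMod 3))) = η q • ∑ l, (![![1, 0], ![0, 1], ![1, 1], ![1, 2]] : Fin 4 → Fin 2 → ZMod 3) (Lrow v a) l • c v l)
    (hrowcode : ∀ v : Fin 4, (v = 2 ∨ v = 3) → ∀ a bb : Fin 4, Lrow v a = Lrow v bb ↔ K4Defs.same (rowcode v) a bb = true)
    (hZKcol : ∀ v μ : Fin 4, (μ = 0 ∨ μ = 2) → (v = 2 ∨ v = 3) → ∃ (w : ZMod 3) (sx s₀ : Fin 4), w ≠ 0 ∧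
      (∀ q : Fin 2, β.w (K4Defs.cellTerm v μ) q = (w * (![![1, 0], ![0, 1], ![1, 1], ![1, 2]] : Fin 4 → Fin 2 → ZMod 3) ((![0, 0, 1, 0] : Fin 4 → Fin 4) μ) q) • ∑ l, (![![1, 0], ![0, 1], ![1, 1], ![1, 2]] : Fin 4 → Fin 2 → ZMod 3) sx l • b μ l) ∧
      sx ≠ s₀ ∧ Matrix.vecMul ((![![1, 0], ![0, 1], ![1, 1], ![1, 2]] : Fin 4 → Fin 2 → ZMod 3) s₀) (Matrix.of fun l m => b μ l ⬝ᵥ c v m : Matrix (Fin 2) (Fin 2) (ZMod 3)) = 0 ∧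
      (∀ y : Fin 2 → ZMod 3, Matrix.vecMul y (Matrix.of fun l m => b μ l ⬝ᵥ c v m : Matrix (Fin 2) (Fin 2) (ZMod 3)) = 0 → (y 0 * (![![1, 0], ![0, 1], ![1, 1], ![1, 2]] : Fin 4 → Fin 2 → ZMod 3) s₀ 1 - y 1 * (![![1, 0], ![0, 1], ![1, 1], ![1, 2]] : Fin 4 → Fin 2 → ZMod 3) s₀ 0) = 0))
    (Y : Matrix (Fin 2) (Fin 2) (ZMod 3)) (vs μs mt : Fin 4) (hμs : μs = 0 ∨ μs = 2) (hvs : vs = 2 ∨ vs = 3) (hmt : mt ≠ μs)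
    (hkill : K4Defs.kills (rowcode vs) mt μs = false)
    (hY : (![![1, 0], ![0, 1], ![1, 1], ![1, 2]] : Fin 4 → Fin 2 → ZMod 3) μs ⬝ᵥ (Y *ᵥ (![![1, 0], ![0, 1], ![1, 1], ![1, 2]] : Fin 4 → Fin 2 → ZMod 3) ((![0, 0, 1, 0] : Fin 4 → Fin 4) μs)) ≠ 0) :
    (∑ p, ∑ q, Y q p * (β.w (K4Defs.cellTerm vs μs) p ⬝ᵥ (fun jj => β.g (K4Defs.cellTerm vs mt) (Matrix.single q jj (1 : ZMod 3))))) ≠ 0 := by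
  classical
  obtain ⟨hcell, hR4, hC4, hnu⟩ := K4EntryNonzero.aux_facts
  have htsingle : K4Defs.singleB (vs, mt) = true := by
    revert hvs; unfold K4Defs.singleB; simp only [Bool.or_eq_true, Bool.and_eq_true, decide_eq_true_eq]; intro h; exact Or.inr h
  obtain ⟨htR, htC, -, htC'⟩ := hcell (vs, mt) htsingle
  simp only at htR htC htC'
  set s := K4Defs.cellTerm vs μs with hsdef
  set t := K4Defs.cellTerm vs mt with htdef
  obtain ⟨w, sx, s₀, hw, hshape, hss₀, hs₀, hs₀max⟩ := hZKcol vs μs hμs hvs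
  -- the Y-form coefficient matrix of `t` in the frame `c vs`
  have hAex : ∃ A : Matrix (Fin 2) (Fin 2) (ZMod 3), ∀ κ, (fun jj => β.g t (Matrix.single κ jj (1 : ZMod 3))) = ∑ l, A κ l • c vs l := by
    choose a ha using hcr vs t htR
    exact ⟨Matrix.of fun κ l => a κ l, fun κ => ha κ⟩
  obtain ⟨A, hA⟩ := hAex
  -- cheapness of `t` for the column plane `μs` (in pairing form)
  have hcheap : ∀ m, ∑ i, b μs m i * (Matrix.vecMul (![-((![![1, 0], ![0, 1], ![1, 1], ![1, 2]] : Fin 4 → Fin 2 → ZMod 3) μs 1), (![![1, 0], ![0, 1], ![1, 1], ![1, 2]] : Fin 4 → Fin 2 → ZMod 3) μs 0] : Fin 2 → ZMod 3)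
      (fun q jj => β.g t (Matrix.single q jj (1 : ZMod 3)))) i = 0 := by
    intro m
    have h := hbch μs t (htC' μs hmt.symm) m
    rw [CheapSpans.g_vecMulVec_eq_sum] at h
    exact h
  -- maximality of the null line of the block `(b μs · c vs)` in combination form
  have hmax : ∀ y : Fin 2 → ZMod 3, (∀ m, (∑ l, y l • b μs l) ⬝ᵥ c vs m = 0) → (y 0 * (![![1, 0], ![0, 1], ![1, 1], ![1, 2]] : Fin 4 → Fin 2 → ZMod 3) s₀ 1 - y 1 * (![![1, 0], ![0, 1], ![1, 1], ![1, 2]] : Fin 4 → Fin 2 → ZMod 3) s₀ 0) = 0 := by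
    intro y hy
    refine hs₀max y ?_
    funext m; rw [← GramNondeg.combo_dotProduct_eq_vecMul]; exact hy m
  have hu : ∃ l, c vs l ⬝ᵥ (∑ m, (![![1, 0], ![0, 1], ![1, 1], ![1, 2]] : Fin 4 → Fin 2 → ZMod 3) sx m • b μs m) ≠ 0 := ZKEntries.exists_b_dot_ne_zero (b μs) (c vs) sx s₀ hss₀ hmax
  -- the z-vector (G side) is non-zero: by the kind of `t` in the all-ones row `vs`
  have hz : (fun p => (fun q jj => β.g t (Matrix.single q jj (1 : ZMod 3))) p ⬝ᵥ ∑ m, (![![1, 0], ![0, 1], ![1, 1], ![1, 2]] : Fin 4 → Fin 2 → ZMod 3) sx m • b μs m) ≠ 0 := by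
    by_cases hpm : K4Defs.pairMask (rowcode vs) mt = true
    · obtain ⟨bb, cc, dd, h1, h2, h3, h4, h5, h6, hsab, hsac, hsad, hscd⟩ := K4Codes.pair_data (rowcode vs) mt hpm
      have hLab : Lrow vs mt = Lrow vs bb := (hrowcode vs hvs mt bb).mpr hsab
      have hLac : Lrow vs mt ≠ Lrow vs cc := fun h => by have := (hrowcode vs hvs mt cc).mp h; rw [hsac] at this; exact Bool.false_ne_true this
      have hLad : Lrow vs mt ≠ Lrow vs dd := fun h => by have := (hrowcode vs hvs mt dd).mp h; rw [hsad] at this; exact Bool.false_ne_true this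
      have hLcd : Lrow vs cc ≠ Lrow vs dd := fun h => by have := (hrowcode vs hvs cc dd).mp h; rw [hscd] at this; exact Bool.false_ne_true this
      have hsees := ColumnSubcomp.sees_cheap_input β _ (hnu mt) ((![{16, 17, 20, 24}, {11, 15, 19, 23}, {13, 14, 22, 26}, {12, 18, 21, 25}] : Fin 4 → Finset (Fin 27)) mt) (hC4 mt) (b mt) (hbi mt) (hbch mt) t htC
      have hdet := InvertibleAtPairs.det_ne_zero_row β (c vs) b (Lrow vs) (hLa vs hvs) (hLb vs hvs) t A hA mt bb cc dd h1 h2 h3 h4 h5 h6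
        hLab hLac hLad hLcd (fun j hj => hbch j t (htC' j hj)) hsees
      exact ZKEntries.z_ne_zero_of_det (fun q jj => β.g t (Matrix.single q jj (1 : ZMod 3))) (c vs) A hA hdet _ hu
    · have hpm' : K4Defs.pairMask (rowcode vs) mt = false := by
        cases h : K4Defs.pairMask (rowcode vs) mt
        · rfl
        · exact absurd h hpm
      obtain ⟨a, bb, hab, hja, hjb, hsame, hkills⟩ := K4Codes.offpair_data (rowcode vs) mt hpm'
      have hLab : Lrow vs a = Lrow vs bb := (hrowcode vs hvs a bb).mpr hsame
      obtain ⟨η, hη⟩ := hLf vs hvs a bb mt hab hLab hja hjb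
      have hη0 : η ≠ 0 := by
        intro h0
        obtain ⟨m, hm⟩ := ColumnSubcomp.sees_cheap_input β _ (hnu mt) ((![{16, 17, 20, 24}, {11, 15, 19, 23}, {13, 14, 22, 26}, {12, 18, 21, 25}] : Fin 4 → Finset (Fin 27)) mt) (hC4 mt) (b mt) (hbi mt) (hbch mt) t htC
        apply hm
        rw [CheapSpans.g_vecMulVec_eq_sum]
        have hG0 : (Matrix.of fun q jj => β.g t (Matrix.single q jj (1 : ZMod 3))) = 0 := by
          ext q jj
          have := congrFun (hη q) jj
          rw [Matrix.of_apply, this, h0]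
          simp
        rw [hG0, Matrix.vecMul_zero]
        simp
      have hane : Lrow vs a ≠ Lrow vs μs := by
        intro h
        have h1 : K4Defs.same (rowcode vs) μs a = true := (hrowcode vs hvs μs a).mp h.symm
        rw [← hkills μs] at h1
        rw [hkill] at h1
        exact Bool.false_ne_true h1
      have hk := ZKEntries.kcov_dot_ne_zero (b μs) (c vs) sx s₀ (Lrow vs a) (Lrow vs μs) hss₀ hane hmax (hLa vs hvs μs)
      exact ZKEntries.z_ne_zero_of_rankOne (fun q jj => β.g t (Matrix.single q jj (1 : ZMod 3))) η _ hη hη0 _ hk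
  -- assemble: transpose symmetry, then the z-vector criterion with the roles of (G, c) and (W, b) exchanged
  rw [Q_symm]
  refine (ZKEntries.Q_ne_zero_iff Yᵀ (fun q jj => β.g t (Matrix.single q jj (1 : ZMod 3))) (β.w s) (fun q => w * (![![1, 0], ![0, 1], ![1, 1], ![1, 2]] : Fin 4 → Fin 2 → ZMod 3) ((![0, 0, 1, 0] : Fin 4 → Fin 4) μs) q) (b μs)
    ((![![1, 0], ![0, 1], ![1, 1], ![1, 2]] : Fin 4 → Fin 2 → ZMod 3) sx) hshape μs hcheap).mpr ⟨hz, ?_⟩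
  have hη : (fun q => w * (![![1, 0], ![0, 1], ![1, 1], ![1, 2]] : Fin 4 → Fin 2 → ZMod 3) ((![0, 0, 1, 0] : Fin 4 → Fin 4) μs) q) ⬝ᵥ (Yᵀ *ᵥ (![![1, 0], ![0, 1], ![1, 1], ![1, 2]] : Fin 4 → Fin 2 → ZMod 3) μs) = w * ((![![1, 0], ![0, 1], ![1, 1], ![1, 2]] : Fin 4 → Fin 2 → ZMod 3) μs ⬝ᵥ (Y *ᵥ (![![1, 0], ![0, 1], ![1, 1], ![1, 2]] : Fin 4 → Fin 2 → ZMod 3) ((![0, 0, 1, 0] : Fin 4 → Fin 4) μs))) := by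
    have hT : (![![1, 0], ![0, 1], ![1, 1], ![1, 2]] : Fin 4 → Fin 2 → ZMod 3) ((![0, 0, 1, 0] : Fin 4 → Fin 4) μs) ⬝ᵥ (Yᵀ *ᵥ (![![1, 0], ![0, 1], ![1, 1], ![1, 2]] : Fin 4 → Fin 2 → ZMod 3) μs) = (![![1, 0], ![0, 1], ![1, 1], ![1, 2]] : Fin 4 → Fin 2 → ZMod 3) μs ⬝ᵥ (Y *ᵥ (![![1, 0], ![0, 1], ![1, 1], ![1, 2]] : Fin 4 → Fin 2 → ZMod 3) ((![0, 0, 1, 0] : Fin 4 → Fin 4) μs)) := by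
      rw [Matrix.dotProduct_mulVec, Matrix.vecMul_transpose, dotProduct_comm]
    rw [← hT]
    simp only [dotProduct, Fin.sum_univ_two]; ring
  rw [hη]
  exact mul_ne_zero hw hY

end K4EntryNonzeroCZ

end Summit.MatrixMultiplication.OmegaCensus.SmallFormats
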